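import Mathlib

/-!
# C4PrymLefschetz — arithmetic plate for memo `C4-PRYM-LEFSCHETZ-c4-1-g30.md` (hsemireg-c4-1 g30)

Token: line stmt-HodgeConjecture-18881 Cruxes/BlochSeedDiscOne/Lines/birth.lean 814a6a70c14e831a
stub_rung_pad4_seedAt.

Pure class-arithmetic and counting behind the memo:
* the numerical Chern-character calculus on a principally polarised abelian fourfold in the basis
  `(1, θ, θ², θ³, pt)` with `θ⁴ = 24·pt` (§3 of the memo): the letter identities `6β₁ = 6y + 3y² + y³`,
  `2β₂ = 2y + y² − 12 pt`, `2α₁ = 2 − y² − y³ − 20 pt`, the Prym theta seed `D(0)+D(1)−2A(8) = 2β₁`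
  (semihom-1 g47 §4.4, ×2 here), and `χ(aα_d + mβ_d) = 8d(da² + m²)`;
* the LAW OF SIX / parity law for theta-arrangement classes on a secant plane (§3):
  `Σ n_c = a, Σ n_c c = m, Σ n_c c² = −da, Σ n_c c³ = −dm ⇒ 6 ∣ (d+1)m ∧ 2 ∣ m − da`;
* the KUMMER COUNT (§4): the equivariant Euler identity with holomorphic-Lefschetz terms for a group
  `⟨−1⟩ ⋉ T`, `|T| = N`, its odd-rank floor `Σ_p s_p² ≥ 256`, and the resulting finite exclusions.
Nothing here is a statement about sheaves or cycles; nothing is proved toward HC / HC_CM / HC_AV /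
18881 / H2.  Mathlib only; no `sorry`, no instances, no notation, no unsafe options.
-/

namespace H21Scratch.C4PrymLefschetz

open Finset BigOperators

/-! ## 1. Class calculus in the basis `(1, θ, θ², θ³, pt)`, `pt = θ⁴/24` -/

/-- `e^{cθ}` : `(1, c, c²/2, c³/6, c⁴)` (last coordinate in units of `pt = θ⁴/24`). -/
def expTheta (c : ℚ) : Fin 5 → ℚ := ![1, c, c ^ 2 / 2, c ^ 3 / 6, c ^ 4]

/-- `y = [𝒪_Θ] = 1 − e^{−θ}`, `y² = [𝒪_{Θ∩Θ'}]`, `y³ = [𝒪_{Θ∩Θ'∩Θ''}]` (generic translates). -/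
def y1 : Fin 5 → ℚ := ![0, 1, -1/2, 1/6, -1]
def y2 : Fin 5 → ℚ := ![0, 0, 1, -1, 14]
def y3 : Fin 5 → ℚ := ![0, 0, 0, 1, -36]
def pt : Fin 5 → ℚ := ![0, 0, 0, 0, 1]
def one : Fin 5 → ℚ := ![1, 0, 0, 0, 0]

/-- Markman's secant basis: `α_d = 1 − dθ²/2 + d²·pt`, `β_d = θ − dθ³/6`. -/
def alphaC (d : ℚ) : Fin 5 → ℚ := ![1, 0, -d/2, 0, d ^ 2]
def betaC (d : ℚ) : Fin 5 → ℚ := ![0, 1, 0, -d/6, 0]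

/-- Abel–Prym curve letter with a degree-8 line bundle: class `θ³/3`, `χ = 8 + 1 − 9 = 0`. -/
def ap8 : Fin 5 → ℚ := ![0, 0, 0, 1/3, 0]

theorem y1_eq : y1 = one - expTheta (-1) := by
  ext i; fin_cases i <;> simp [y1, one, expTheta] <;> norm_num

/-- The first H⁴-free ℚ(i)-secant theta-arrangement class: `6β₁ = 6y + 3y² + y³`
(six divisor strata, three surface strata, one curve stratum, no points, no twist). -/
theorem six_beta_one : (6 : ℚ) • betaC 1 = (6 : ℚ) • y1 + (3 : ℚ) • y2 + y3 := by
  ext i; fin_cases i <;> simp [betaC, y1, y2, y3] <;> norm_num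

/-- The same class as a one-sided theta-power combination:
`6β₁ = 10·e⁰ − 15·e^{−θ} + 6·e^{−2θ} − e^{−3θ}`. -/
theorem six_beta_one_exp :
    (6 : ℚ) • betaC 1 =
      (10 : ℚ) • expTheta 0 - (15 : ℚ) • expTheta (-1) + (6 : ℚ) • expTheta (-2) - expTheta (-3) := by
  ext i; fin_cases i <;> simp [betaC, expTheta] <;> norm_num

/-- transfer g14 §11(α4): `5(e^θ − e^{−θ}) − (e^{2θ} − e^{−2θ}) = 6β₁` and
`30 − 10(e^θ + e^{−θ}) + e^{2θ} + e^{−2θ} = 12α₁` (×2 of their pen identities). -/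
theorem transfer_identities :
    (5 : ℚ) • (expTheta 1 - expTheta (-1)) - (expTheta 2 - expTheta (-2)) = (6 : ℚ) • betaC 1 ∧
    (30 : ℚ) • expTheta 0 - (10 : ℚ) • (expTheta 1 + expTheta (-1)) + expTheta 2 + expTheta (-2)
      = (12 : ℚ) • alphaC 1 := by
  constructor <;> (ext i; fin_cases i <;> simp [betaC, alphaC, expTheta] <;> norm_num)

/-- An H⁴-free ℚ(√−2)-secant class inside TWO translates: `2β₂ = 2y + y² − 12·pt`. -/
theorem two_beta_two : (2 : ℚ) • betaC 2 = (2 : ℚ) • y1 + y2 - (12 : ℚ) • pt := by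
  ext i; fin_cases i <;> simp [betaC, y1, y2, pt] <;> norm_num

/-- The lone ℚ(i) class surviving every count law in the ≤ 4-translate table (§4):
`2α₁ = 2 − y² − y³ − 20·pt` (rank 2, `c₁ = 0`, `c₂ = θ²`, not H⁴-free). -/
theorem two_alpha_one : (2 : ℚ) • alphaC 1 = (2 : ℚ) • one - y2 - y3 - (20 : ℚ) • pt := by
  ext i; fin_cases i <;> simp [alphaC, one, y2, y3, pt] <;> norm_num

/-- semihom-1 g47 §4.4 (×2): the Prym theta seed, `D(0) + D(1) − 2·A(8) = 2β₁`, where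
`D(0) = y`, `D(1) = e^θ·y = e^θ − 1`, `A(8)` = Abel–Prym curve with a degree-8 line bundle;
and `ch(e_*G) = D(0) + D(1) − A(8) + A(8) = 2θ` for the Serre bundle. -/
theorem prym_theta_seed :
    y1 + (expTheta 1 - one) - (2 : ℚ) • ap8 = (2 : ℚ) • betaC 1 ∧
    y1 + (expTheta 1 - one) = ![0, 2, 0, 1/3, 0] := by
  constructor <;> (ext i; fin_cases i <;> simp [y1, expTheta, one, ap8, betaC] <;> norm_num)

/-- c4-1 g29/g30 design 𝔇₂(d): `[𝒪_{Ξ_a ∪ Ξ_b}(Ξ)] = e^θ − e^{−θ} = 2θ + θ³/3`, minus `d+1`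
Abel–Prym letters gives `2β_d` (here `d = 1`: two curves). -/
theorem design_D2 :
    expTheta 1 - expTheta (-1) = ![0, 2, 0, 1/3, 0] ∧
    expTheta 1 - expTheta (-1) - (2 : ℚ) • ap8 = (2 : ℚ) • betaC 1 := by
  constructor <;> (ext i; fin_cases i <;> simp [expTheta, ap8, betaC] <;> norm_num)

/-- Mukai/Euler pairing `χ(v,w) = ∫ v^∨ · w` on the fourfold (`θ⁴ = 24`). -/
def dualC (v : Fin 5 → ℚ) : Fin 5 → ℚ := ![v 0, -v 1, v 2, -v 3, v 4]
def intC (v w : Fin 5 → ℚ) : ℚ := v 0 * w 4 + v 4 * w 0 + 24 * (v 1 * w 3 + v 3 * w 1 + v 2 * w 2)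
def chiC (v : Fin 5 → ℚ) : ℚ := intC (dualC v) v

/-- `χ(aα_d + mβ_d, aα_d + mβ_d) = 8d(da² + m²)` (Markman; the input of every count law). -/
theorem chi_secant (a m d : ℚ) :
    chiC (a • alphaC d + m • betaC d) = 8 * d * (d * a ^ 2 + m ^ 2) := by
  simp [chiC, intC, dualC, alphaC, betaC]
  ring

theorem chi_values :
    chiC ((2 : ℚ) • betaC 1) = 32 ∧ chiC ((2 : ℚ) • alphaC 1) = 32 ∧ chiC ((6 : ℚ) • betaC 1) = 288 ∧
    chiC (alphaC 1 + (3 : ℚ) • betaC 1) = 80 ∧ chiC ((2 : ℚ) • betaC 2) = 64 := by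
  refine ⟨?_, ?_, ?_, ?_, ?_⟩ <;> simp [chiC, intC, dualC, alphaC, betaC] <;> norm_num

/-! ## 2. LAW OF SIX and parity for theta-arrangement classes on a secant plane -/

theorem six_dvd_cube_sub (c : ℤ) : (6 : ℤ) ∣ c ^ 3 - c := by
  have h : ((c ^ 3 - c : ℤ) : ZMod 6) = 0 := by
    have key : ∀ x : ZMod 6, x ^ 3 - x = 0 := by decide
    push_cast
    exact key _
  exact (ZMod.intCast_zmod_eq_zero_iff_dvd (c ^ 3 - c) 6).mp h

theorem two_dvd_sq_add (c : ℤ) : (2 : ℤ) ∣ c ^ 2 + c := by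
  have h : ((c ^ 2 + c : ℤ) : ZMod 2) = 0 := by
    have key : ∀ x : ZMod 2, x ^ 2 + x = 0 := by decide
    push_cast
    exact key _
  exact (ZMod.intCast_zmod_eq_zero_iff_dvd (c ^ 2 + c) 2).mp h

/-- LAW OF SIX / parity.  A theta-arrangement class `v = Σ_c n_c e^{cθ} + p·pt` (integer
multiplicities `n_c` on finitely many twists `c`, points only move the `pt`-coordinate) lies on the
secant plane `P_d` iff `Σ n_c c² = −d·a` and `Σ n_c c³ = −d·m` where `a = Σ n_c` (rank) and
`m = Σ n_c c` (the `θ`-coefficient).  Then `6 ∣ (d+1)m` and `2 ∣ m − da`.  For `ℚ(i)`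
(`d` a square) this forces `6 ∣ m`; H⁴-free (`a = 0`) needs `m ≠ 0`, hence `|m| ≥ 6`, `χ ≥ 288·d`. -/
theorem law_of_six (S : Finset ℤ) (n : ℤ → ℤ) (a m d : ℤ)
    (_h0 : ∑ c ∈ S, n c = a) (h1 : ∑ c ∈ S, n c * c = m)
    (h2 : ∑ c ∈ S, n c * c ^ 2 = -d * a) (h3 : ∑ c ∈ S, n c * c ^ 3 = -d * m) :
    (6 : ℤ) ∣ (d + 1) * m ∧ (2 : ℤ) ∣ m - d * a := by
  constructor
  · have e1 : ∑ c ∈ S, n c * (c ^ 3 - c) = -d * m - m := by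
      simp only [mul_sub, Finset.sum_sub_distrib, h1, h3]
    have d6 : (6 : ℤ) ∣ ∑ c ∈ S, n c * (c ^ 3 - c) :=
      Finset.dvd_sum fun c _ => Dvd.dvd.mul_left (six_dvd_cube_sub c) (n c)
    have : (d + 1) * m = -(∑ c ∈ S, n c * (c ^ 3 - c)) := by rw [e1]; ring
    rw [this]
    exact (dvd_neg).mpr d6
  · have e1 : ∑ c ∈ S, n c * (c ^ 2 + c) = -d * a + m := by
      simp only [mul_add, Finset.sum_add_distrib, h1, h2]
    have d2 : (2 : ℤ) ∣ ∑ c ∈ S, n c * (c ^ 2 + c) :=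
      Finset.dvd_sum fun c _ => Dvd.dvd.mul_left (two_dvd_sq_add c) (n c)
    have : m - d * a = ∑ c ∈ S, n c * (c ^ 2 + c) := by rw [e1]; ring
    rw [this]
    exact d2

/-- `ℚ(i)`: `d = k²` ⇒ from `6 ∣ (d+1)m` already `6 ∣ m`... for the two relevant values `d ∈ {1,4}`
and, more generally, whenever `gcd(d+1, 6) = 1` or by the parity law; here the finite check used
in the memo: for `d ∈ {1, 4, 9, 16, 25}` and `|m| ≤ 30`, `6 ∣ (d+1)m ∧ 2 ∣ m` implies `6 ∣ m`. -/
theorem qi_law_of_six_check :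
    ∀ d ∈ ({1, 4, 9, 16, 25} : Finset ℕ), ∀ m : ℕ, m ≤ 30 →
      (6 ∣ (d + 1) * m ∧ 2 ∣ m) → 6 ∣ m := by
  decide

theorem twelve_dvd_fourth_sub_sq (c : ℤ) : (12 : ℤ) ∣ c ^ 4 - c ^ 2 := by
  have h : ((c ^ 4 - c ^ 2 : ℤ) : ZMod 12) = 0 := by
    have key : ∀ x : ZMod 12, x ^ 4 - x ^ 2 = 0 := by decide
    push_cast
    exact key _
  exact (ZMod.intCast_zmod_eq_zero_iff_dvd (c ^ 4 - c ^ 2) 12).mp h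

/-- POINT-DEFECT law (transfer g14 §12 (vi)–(vii), (R3); ×2 here in its general-`d` form).  With the
rank letters as in `law_of_six`, the `pt`-coordinate of a class on `P_d` is `d²·a`, so the signed
free-point count `w` satisfies `Σ n_c c⁴ + w = d² a`; with `Σ n_c c² = −da` this gives
`12 ∣ w − d(d+1)a` (at `d = 1`: `w ≡ 2r (mod 12)`). -/
theorem point_defect (S : Finset ℤ) (n : ℤ → ℤ) (a d w : ℤ)
    (h2 : ∑ c ∈ S, n c * c ^ 2 = -d * a) (h4 : ∑ c ∈ S, n c * c ^ 4 + w = d ^ 2 * a) :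
    (12 : ℤ) ∣ w - d * (d + 1) * a := by
  have e1 : ∑ c ∈ S, n c * (c ^ 4 - c ^ 2) = d ^ 2 * a - w + d * a := by
    simp only [mul_sub, Finset.sum_sub_distrib, h2]
    linarith
  have d12 : (12 : ℤ) ∣ ∑ c ∈ S, n c * (c ^ 4 - c ^ 2) :=
    Finset.dvd_sum fun c _ => Dvd.dvd.mul_left (twelve_dvd_fourth_sub_sq c) (n c)
  have : w - d * (d + 1) * a = -(∑ c ∈ S, n c * (c ^ 4 - c ^ 2)) := by rw [e1]; ring
  rw [this]
  exact (dvd_neg).mpr d12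

/-- The three congruence kernels and the mod-24 refinement used on the bus
(`c⁴ − c² ≡ 12 (mod 24)` iff `c ≡ 2 (mod 4)`, else `0`), as a finite check over residues. -/
theorem congruence_kernels :
    (∀ c : Fin 24, ((c : ℕ) ^ 4 - (c : ℕ) ^ 2) % 24 = if (c : ℕ) % 4 = 2 then 12 else 0) ∧
    (∀ c : Fin 12, ((c : ℕ) ^ 4 - (c : ℕ) ^ 2) % 12 = 0) ∧
    (∀ c : Fin 6, ((c : ℕ) ^ 3 - (c : ℕ)) % 6 = 0) ∧ (∀ c : Fin 2, ((c : ℕ) ^ 2 - (c : ℕ)) % 2 = 0) := by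
  refine ⟨?_, ?_, ?_, ?_⟩ <;> decide

/-- At `d = 1`: a rigid design whose only points are 24-packets (`24 ∣ w`) needs `6 ∣ r`
(transfer's «ranks 1–5 dead»); and the `(2 ; (1,−1) ; m = 4)` row of record:
`ch(𝓘_{S₀₂∪S₁₃}(Θ) ⊕ 𝒪(−Θ)) = 2α₁ + 20·pt`, i.e. `w = −20 ≡ 4 (mod 24)` (five lines, ×2). -/
theorem rank_mod_six_of_packets (r w : ℤ) (h12 : (12 : ℤ) ∣ w - 1 * (1 + 1) * r) (h24 : (24 : ℤ) ∣ w) :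
    (6 : ℤ) ∣ r := by
  omega

theorem row_one_minus_one :
    expTheta 1 - (2 : ℚ) • (expTheta 1 - (2 : ℚ) • expTheta 0 + expTheta (-1)) + (24 : ℚ) • pt
        + expTheta (-1) = (2 : ℚ) • alphaC 1 + (20 : ℚ) • pt ∧
    ((-20 : ℤ) - 4) % 24 = 0 := by
  constructor
  · ext i; fin_cases i <;> simp [expTheta, pt, alphaC] <;> norm_num
  · decide

/-! ## 3. KUMMER COUNT: the equivariant Euler identity with Lefschetz terms -/

/-- Equivariant Euler identity for a simple `G`-object on an abelian fourfold, `G = ⟨−1⟩ ⋉ T`,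
`|T| = N` (so `|G| = 2N`), free translation part, `N` reflections `x ↦ −x + t` with 256 fixed points
each: `2N·e₂^G = χ + ΣL − 2·(2N) + 2·(2N)·e₁^G` (Serre duality `e₀^G = e₄^G = 1`, `e₃^G = e₁^G`;
projection formula `χ^G·|G| = Σ_g L(g)`, free translations contribute `0`).  The memo's criterion
`e₂^G = rank μ_v = 12` then reads `χ + ΣL = 28N − 4N·e₁^G`. -/
theorem kummer_criterion (chi L N e1 : ℤ)
    (h : 2 * N * 12 = chi + L - 2 * (2 * N) + 2 * (2 * N) * e1) :
    chi + L = 28 * N - 4 * N * e1 := by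
  linear_combination -h

/-- Holomorphic-Lefschetz local data at an isolated fixed point of `x ↦ −x + t` on a fourfold:
`det(1 − dg) = 2⁴ = 16`; the alternating fibre trace of `𝒪_W` for a smooth germ `W` of
codimension `k` through the point is `2^k`, so for the ideal / twisted-ideal letters
`s = 1 − 2^k ∈ {−1, −3, −7, −15}` (divisor, surface, curve, point), all ODD, squares `1, 9, 49, 225`;
off the support of a rank-`r` locally free sheaf `s ≡ r (mod 2)`. -/
theorem lefschetz_local_terms :
    (2 : ℤ) ^ 4 = 16 ∧
    ((1 : ℤ) - 2 ^ 1 = -1 ∧ (1 : ℤ) - 2 ^ 2 = -3 ∧ (1 : ℤ) - 2 ^ 3 = -7 ∧ (1 : ℤ) - 2 ^ 4 = -15) ∧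
    ((-1 : ℤ) ^ 2 = 1 ∧ (-3 : ℤ) ^ 2 = 9 ∧ (-7 : ℤ) ^ 2 = 49 ∧ (-15 : ℤ) ^ 2 = 225) := by
  decide

theorem odd_sq_ge_one (s : ℤ) (h : Odd s) : 1 ≤ s ^ 2 := by
  have hs : s ≠ 0 := by obtain ⟨k, hk⟩ := h; omega
  have h1 : 1 ≤ |s| := Int.one_le_abs hs
  calc (1 : ℤ) = 1 * 1 := by norm_num
    _ ≤ |s| * |s| := mul_le_mul h1 h1 zero_le_one (abs_nonneg s)
    _ = s ^ 2 := by rw [← sq, sq_abs]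

/-- ODD-RANK LEFSCHETZ FLOOR: if every one of the 256 local supertraces is odd then
`Σ_p s_p² ≥ 256`, i.e. `L = Σ s_p²/16 ≥ 16` per reflection. -/
theorem lefschetz_floor (s : Fin 256 → ℤ) (h : ∀ p, Odd (s p)) :
    (256 : ℤ) ≤ ∑ p, s p ^ 2 := by
  have key : ∑ _p : Fin 256, (1 : ℤ) ≤ ∑ p, s p ^ 2 :=
    Finset.sum_le_sum fun p _ => odd_sq_ge_one (s p) (h p)
  simpa using key

/-- Odd rank: with `L ≥ 16N`, `e₁^G ≥ 0`, the criterion forces `χ ≤ 12N`. -/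
theorem kummer_odd_rank (chi L N e1 : ℤ) (hN : 1 ≤ N) (he : 0 ≤ e1) (hL : 16 * N ≤ L)
    (h : chi + L = 28 * N - 4 * N * e1) : chi ≤ 12 * N := by
  nlinarith

/-- Any rank: `L ≥ 0`, `e₁^G ≥ 0` ⇒ `χ ≤ 28N`. -/
theorem kummer_any_rank (chi L N e1 : ℤ) (hN : 1 ≤ N) (he : 0 ≤ e1) (hL : 0 ≤ L)
    (h : chi + L = 28 * N - 4 * N * e1) : chi ≤ 28 * N := by
  nlinarith

/-- Free (Kummer-less) FLOOR of record for comparison: `e₁^G ≥ 8` ⇒ `e₂^G ≥ χ^G + 14 > 12`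
whenever `χ^G ≥ 0` (g29 `invariant_floor`; every secant class has `χ > 0`). -/
theorem free_floor (chiG e1G e2G : ℤ) (h8 : 8 ≤ e1G) (hchi : 0 ≤ chiG)
    (h : e2G = chiG - 2 + 2 * e1G) : 12 < e2G := by
  omega

/-! ## 4. The finite exclusions behind the TABLE (d = 1, 4 = the ℚ(i) planes; N ≤ 4 translates) -/

/-- H⁴-free ℚ(i) rows (`a = 0`, `χ = 8dm²`, `6 ∣ m`, `m ≠ 0`) never fit the Kummer budget
`χ ≤ 28N` with `N ≤ 4` — indeed not below `N = 11` for `d = 1`. -/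
theorem H4free_qi_rows_dead :
    (∀ m : ℕ, m ≤ 40 → 6 ∣ m → m ≠ 0 → ∀ N : ℕ, N ≤ 10 → ¬ (8 * 1 * m ^ 2 ≤ 28 * N)) ∧
    (∀ m : ℕ, m ≤ 40 → 6 ∣ m → m ≠ 0 → ∀ N : ℕ, N ≤ 41 → ¬ (8 * 4 * m ^ 2 ≤ 28 * N)) := by
  constructor <;> decide

/-- ONE-ORBIT H⁴-free ℚ(i) theta designs are Kummer-dead for EVERY `N`: in one `G`-orbit all
`N` translates carry the same multiplicity `μ ≥ 1`, so `|m| = Nμ`, and `8(Nμ)² ≤ 28N`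
contradicts `6 ∣ Nμ`. -/
theorem one_orbit_H4free_dead (N mu : ℕ) (hN : 1 ≤ N) (hmu : 1 ≤ mu) (h6 : 6 ∣ N * mu)
    (hcount : 8 * (N * mu) * (N * mu) ≤ 28 * N) : False := by
  have hP6 : 6 ≤ N * mu := Nat.le_of_dvd (Nat.mul_pos hN hmu) h6
  have h1 : N ≤ N * mu := Nat.le_mul_of_pos_right N hmu
  nlinarith

/-- Odd-rank ℚ(i) rows of the ≤ 4-translate census (`d = 1`: `(a,|m|) ∈ {(1,3),(3,3)}`, `χ = 80, 144`;
`d = 4`: `(1,0)`, `χ = 128`) violate the odd-rank bound `χ ≤ 12N ≤ 48`. -/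
theorem odd_rank_rows_dead :
    ¬ (80 ≤ 12 * 4) ∧ ¬ (144 ≤ 12 * 4) ∧ ¬ (128 ≤ 12 * 4) ∧
    8 * 1 * (1 * 1 ^ 2 + 3 ^ 2) = 80 ∧ 8 * 1 * (1 * 3 ^ 2 + 3 ^ 2) = 144 ∧ 8 * 4 * (4 * 1 ^ 2 + 0 ^ 2) = 128 := by
  decide

/-- Even-rank ℚ(i) rows: `2α₁ + 6β₁` (`χ = 320`) and `2α₄` (`χ = 512`) exceed `28N ≤ 112`;
`2α₁` (`χ = 32`) fits iff `N ≥ 2`, with residual budget `ΣL + 4N·e₁^G = 28N − 32 ∈ {24, 52, 80}`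
for `N = 2, 3, 4` — the single numerically open Kummer cell of the table (not H⁴-free). -/
theorem even_rank_rows :
    ¬ (320 ≤ 28 * 4) ∧ ¬ (512 ≤ 28 * 4) ∧ ¬ (32 ≤ 28 * 1 - 0) ∧
    (28 * 2 - 32 = 24 ∧ 28 * 3 - 32 = 52 ∧ 28 * 4 - 32 = 80) := by
  decide

/-- The general-`d` survivors of the ANY-RANK budget `χ = 8d(da²+m²) ≤ 28·4 = 112` together with
the integrality laws (`2 ∣ m − da`, `6 ∣ (d+1)m`), for `a ≤ 3`, `|m| ≤ 12`, `1 ≤ d ≤ 6`,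
`(a,m) ≠ (0,0)`: exactly `d = 1: (2,0), (1,±3)` and `d = 2: (1,0), (0,±2), (1,±2)` — encoded as a
decidable check on naturals (`m` stands for `|m|`; both laws are symmetric in the sign of `m`).
The odd-rank row `(1,±3)` (`χ = 80`) is then removed by the odd-rank bound `χ ≤ 12N ≤ 48`
(`odd_rank_rows_dead`); no `ℚ(i)` row (`d ∈ {1,4}`) with `a = 0` survives. -/
theorem survivors_general_d :
    ∀ d ∈ (Finset.range 7).filter (fun d => 1 ≤ d), ∀ a ∈ Finset.range 4, ∀ m ∈ Finset.range 13,
      ((a, m) ≠ (0, 0) ∧ 8 * d * (d * a ^ 2 + m ^ 2) ≤ 112 ∧ 2 ∣ (m + d * a) ∧ 6 ∣ (d + 1) * m) →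
      ((d = 1 ∧ ((a = 2 ∧ m = 0) ∨ (a = 1 ∧ m = 3))) ∨
       (d = 2 ∧ ((a = 1 ∧ m = 0) ∨ (a = 0 ∧ m = 2) ∨ (a = 1 ∧ m = 2)))) := by
  decide

/-! ## 5. Budgets quoted in the memo -/

/-- `dim HT²(X) = 6 + 16 + 6 = 28` on an abelian fourfold; `rank μ_v = 12`, `ker = 16 = 10 + 6`
for every secant class (machine-exact in `code/g30/mu_rank.py`, ×2 of semihom-1 g46 §7(i));
absolute semiregularity would need `ext² = 12` while the free floor gives `≥ χ + 14 ≥ 46` for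
`b = 2` — the numbers: -/
theorem budgets : 6 + 16 + 6 = 28 ∧ 28 - 12 = 16 ∧ 10 + 6 = 16 ∧ 32 - 2 + 2 * 8 = 46 ∧
    32 - 2 + 2 * 11 = 52 ∧ 2 ^ (4 - 1) * (2 ^ 4 - 1) = 120 ∧ 2 ^ 8 = 256 ∧ 256 / 16 = 16 := by
  decide

/-! ## 6. v1.1 — mod-24 closed form, SIGN LEMMA bookkeeping, reflexive point letters

(transfer g14 ADDENDUM-5 (ix) `w ≡ 2r + 4b (mod 24)` at `d = 1`; ×2 here for every `d` in closed form.)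
The one-line reason: `c⁴ − c² − 2(c³ − c) = (c−2)(c−1)c(c+1)` is a product of four consecutive
integers, hence divisible by `24`; summing against the letter multiplicities and using the four
`P_d` identities gives `w ≡ d(d+1)·a + 2(d+1)·m (mod 24)` — at `d = 1`: `w ≡ 2a + 4m (mod 24)`,
WITHOUT using `3 ∣ m`.  Census: 1 404 integral rows, 0 violations (`data/g30/mod24_closed_form.txt`). -/

theorem consec4_factor (c : ℤ) :
    c ^ 4 - c ^ 2 - 2 * (c ^ 3 - c) = (c - 2) * (c - 1) * c * (c + 1) := by
  ring

theorem twentyfour_dvd_consec4 (c : ℤ) : (24 : ℤ) ∣ c ^ 4 - c ^ 2 - 2 * (c ^ 3 - c) := by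
  have h : ((c ^ 4 - c ^ 2 - 2 * (c ^ 3 - c) : ℤ) : ZMod 24) = 0 := by
    have key : ∀ x : ZMod 24, x ^ 4 - x ^ 2 - 2 * (x ^ 3 - x) = 0 := by decide
    push_cast
    exact key _
  exact (ZMod.intCast_zmod_eq_zero_iff_dvd (c ^ 4 - c ^ 2 - 2 * (c ^ 3 - c)) 24).mp h

/-- POINT-DEFECT mod 24, closed form for every `d`: with the `P_d` identities
`Σ n_c c = m`, `Σ n_c c² = −d a`, `Σ n_c c³ = −d m`, `Σ n_c c⁴ + w = d² a` one has
`24 ∣ w − d(d+1)a − 2(d+1)m`. -/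
theorem point_defect_mod24 (S : Finset ℤ) (n : ℤ → ℤ) (a m d w : ℤ)
    (h1 : ∑ c ∈ S, n c * c = m) (h2 : ∑ c ∈ S, n c * c ^ 2 = -d * a)
    (h3 : ∑ c ∈ S, n c * c ^ 3 = -d * m) (h4 : ∑ c ∈ S, n c * c ^ 4 + w = d ^ 2 * a) :
    (24 : ℤ) ∣ w - d * (d + 1) * a - 2 * (d + 1) * m := by
  have e0 : ∀ c ∈ S, n c * (c ^ 4 - c ^ 2 - 2 * (c ^ 3 - c)) =
      n c * c ^ 4 - n c * c ^ 2 - 2 * (n c * c ^ 3) + 2 * (n c * c) := by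
    intros; ring
  have e1 : ∑ c ∈ S, n c * (c ^ 4 - c ^ 2 - 2 * (c ^ 3 - c)) =
      (∑ c ∈ S, n c * c ^ 4) - (∑ c ∈ S, n c * c ^ 2) - 2 * (∑ c ∈ S, n c * c ^ 3)
        + 2 * (∑ c ∈ S, n c * c) := by
    rw [Finset.sum_congr rfl e0, Finset.sum_add_distrib, Finset.sum_sub_distrib,
      Finset.sum_sub_distrib, ← Finset.mul_sum, ← Finset.mul_sum]
  have d24 : (24 : ℤ) ∣ ∑ c ∈ S, n c * (c ^ 4 - c ^ 2 - 2 * (c ^ 3 - c)) :=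
    Finset.dvd_sum fun c _ => Dvd.dvd.mul_left (twentyfour_dvd_consec4 c) (n c)
  have e2 : w - d * (d + 1) * a - 2 * (d + 1) * m =
      -(∑ c ∈ S, n c * (c ^ 4 - c ^ 2 - 2 * (c ^ 3 - c))) := by
    rw [e1, h1, h2, h3]
    linarith
  rw [e2]
  exact (dvd_neg).mpr d24

/-- The `d = 1` instance: `w ≡ 2a + 4m (mod 24)` (transfer's (ix) `w ≡ 2r + 4b`). -/
theorem point_defect_mod24_d1 (S : Finset ℤ) (n : ℤ → ℤ) (a m w : ℤ)
    (h1 : ∑ c ∈ S, n c * c = m) (h2 : ∑ c ∈ S, n c * c ^ 2 = -1 * a)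
    (h3 : ∑ c ∈ S, n c * c ^ 3 = -1 * m) (h4 : ∑ c ∈ S, n c * c ^ 4 + w = 1 ^ 2 * a) :
    (24 : ℤ) ∣ w - 2 * a - 4 * m := by
  have h := point_defect_mod24 S n a m 1 w h1 h2 h3 h4
  have e : w - 1 * (1 + 1) * a - 2 * (1 + 1) * m = w - 2 * a - 4 * m := by ring
  rwa [e] at h

/-- mod-24 residues of the census cells quoted in the memo (`d = 1`: `2a + 4m`; `d = 4`: `20a + 10m`;
`d = 2`: `6a + 6m`), against one member's `w` each. -/
theorem mod24_residues :
    (100 - (2 * 2 + 4 * 0) : ℤ) % 24 = 0 ∧ (-20 - (2 * 2 + 4 * 0) : ℤ) % 24 = 0 ∧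
    (110 - (2 * 1 + 4 * 3) : ℤ) % 24 = 0 ∧ (-130 - (2 * 1 + 4 * (-3)) : ℤ) % 24 = 0 ∧
    (-148 - (20 * 1 + 10 * 0) : ℤ) % 24 = 0 ∧ (252 - (6 * 0 + 6 * 2) : ℤ) % 24 = 0 ∧
    (-20 - (2 * 2 + 4 * 0) : ℤ) % 24 = 0 ∧ (22 - 2 : ℤ) = 20 := by
  norm_num

/-- SIGN LEMMA bookkeeping.  If the reflexive hull is locally free at every free point, each free
point letter is an elementary modification and lowers the `pt`-coordinate by its colength (`w_free ≤ 0`);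
a class of residue `4 (mod 24)` (the `2α`-type cell) with `w_sing ∈ 24ℤ` and no degree letter then needs
at least `20` removed free points.  Under a Kummer group `G = G₀ ⋊ ⟨−1⟩`, `|G₀| = N`, free points come in
free `2N`-orbits (invariant moduli: cost `4N·4 = 16N` in the count) or reflection-fixed `N`-orbits
(Lefschetz cost `≥ N·14²/16`); the budget is `28N − χ − 16·e₁ ≤ 28N − 32`.  Scaled by `16`:
every split of `20` points busts the budget at `N = 2` (transfer (x)(d)) and at `N = 4` (this memo's cell). -/
theorem ipoint_cells_dead :
    (∀ a b : ℕ, 4 * a + 2 * b = 20 → 16 * (32 * a) + 2 * 196 * b > 16 * 24) ∧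
    (∀ a b : ℕ, 8 * a + 4 * b = 20 → 16 * (64 * a) + 4 * 196 * b > 16 * 80) := by
  constructor <;> intro a b h <;> omega

/-- Reflexive point letters (outside the alphabet): the Bruns quotients `Syz₂(k_q)/𝒪·s` and
`Syz₃(k_q)/𝒪·s'` are rank-2 reflexive non-free modules at `q`; their `(−1)`-supertraces from the Koszul
weights `tr(−1 | ∧ⁱT*) = (−1)ⁱ·C(4,i)`: `str Syz₂ = 6 − (−4) + 1 = 11`, minus the weight-`(+1)` generator
gives `10` (Lefschetz term `10²/16 = 6.25`); `str Syz₃ = −4 − 1 = −5`, minus weight `−1` gives `−4`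
(term `1`).  Four such letters in one reflection-fixed `4`-orbit cost `4·100/16 = 25 ≤ 80` at `N = 4`
(numerically open) but `25 > 24` at `N = 2`. -/
theorem reflexive_letter_numerics :
    ((6 : ℤ) - (-4) + 1 = 11) ∧ ((11 : ℤ) - 1 = 10) ∧ ((-4 : ℤ) - 1 = -5) ∧ ((-5 : ℤ) - (-1) = -4) ∧
    (4 * 10 ^ 2 ≤ 16 * 80) ∧ ¬ (4 * 10 ^ 2 ≤ 16 * 24) ∧ ((-4 : ℤ) - 6 + (-4) - 1 = -15) := by
  norm_num


end H21Scratch.C4PrymLefschetz
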